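import Summits.CriticalPhenomena.SAWScalingLimit.Theorems.SAWRenewalTightnessSubseqIdentificationSleAvoidProduct
import Summits.CriticalPhenomena.SAWScalingLimit.Theorems.SAWRenewalTightnessSubseqIdentificationSleAvoidancePositive
import Summits.CriticalPhenomena.SAWScalingLimit.Theorems.SAWRenewalTightnessSubseqIdentificationThm65TiltedUntilt
import HarnessLib

/-!
# Restriction rigidity below 8/3 from LAW-level parts (line `boundary-area-law`, RS5, reshape r-c4-7)

Line `boundary-area-law` of the crux `SubseqIdentification` (stmt-CriticalPhenomena-0783), restriction reshape
(lead c4). The SLE-side rigidity statement RS5 (`stub_sleRestrictionRigidityBelow`: for `0 < κ < 8/3` the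
SLE_κ laws of `D` and of the carved domain `D ∖ B̄(x₀, r)` at a flat window do NOT satisfy the restriction
identity) was derived r-c4-3 from RS5a (hull form of the identity), RS5b (the tilted [LSW] Theorem 6.5,
PROVED: `stub_thm65Tilted`, 20 files) and RS5c (non-degeneracy of the compensator, reduced to the
deterministic unboundedness UNB — which needs Beurling-type conformal-distance estimates absent from the
tree). This file is the ALTERNATIVE glue that replaces RS5c/UNB by three law-level statements:

* (L1) `TiltedLawIdentity` — under the tilt `X_A · 1_{E_A} · P` (`X_A = exp(−λ_κ L^A)` the compensator
  weight, `E_A = {γ ∩ A = ∅}`, `A` the pulled-back carved half-ball) the SLE curve `Γ` of `D` has law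
  `Φ_A'(0)^α · SLE_κ(D')` (the tilted Theorem 6.5 at law level: `stub_thm65Tilted` + [LSW] Lemma 3.2
  `AvoidanceDeterminesLaw` in `D'`);
* (L2) `CompensatorFactorsThroughCurve` — `X_A` is a measurable function of the curve class `Γ ω`
  (the driving function of a described class is the SLE driver: `drivingFunction`, `measurable_drivingFunction`);
* (L3) `CompensatorEssUnbounded` — for `0 < κ < 8/3` and every nonempty `A ∈ 𝒬*`, `X_A` takes arbitrarily
  small values on `E_A` with positive probability (the compensator `L^A` is essentially unbounded on `E_A`).

**Glue (sorry-free).** Assume the restriction identity. Its canonical form (`sleRestriction_canonical_of_identity`,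
p134861) says `P(E_A ∩ Γ⁻¹T) = μ'(T) · P(E_A)`; with (L1) this gives
`(∫_{E_A ∩ Γ⁻¹T} X_A) · P(E_A) = Φ_A'(0)^α · P(E_A ∩ Γ⁻¹T)` for every measurable `T`; with (L2) the abstract
lemma `ae_eq_const_of_setLIntegral_preimage_eq` forces `X_A · P(E_A) = Φ_A'(0)^α` a.e. on `E_A`, i.e. `X_A` is
a.s. CONSTANT on `E_A` — contradicting (L3) (`P(E_A) > 0` by `sleAvoidance_pos`, p134575).

References: G. F. Lawler, O. Schramm, W. Werner, *Conformal restriction: the chordal case*, JAMS 16 (2003),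
Prop. 5.3, Thm. 6.5, Lemma 3.2; LSW, *On the scaling limit of planar self-avoiding walk* (2004), §2.1 p. 7.
No named fact is used.
-/

noncomputable section

open MeasureTheory Filter Topology Set Metric
open scoped NNReal ENNReal
open Literature.Probability.RandomPlanarGeometry
open Literature.Probability.Process (preWienerMeasure)
open UpperHalfPlane (upperHalfPlaneSet)

namespace Summit.CriticalPhenomena.SAWScalingLimit.Theorems.SubseqIdentification.BoundaryAreaLaw

/-! ### The abstract constancy lemma -/

/-- **Constancy from a family of set-integral identities.** On a finite measure space, if `X ≤ 1` factors
a.e. through `Γ` as `G ∘ Γ` and `(∫_{E ∩ Γ⁻¹T} X) · p = k · P(E ∩ Γ⁻¹T)` for every measurable `T`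
(`p, k` finite), then `X · p = k` a.e. on `E`: test with `T = {G·p < k}` and `T = {k < G·p}` and use the
strict monotonicity of the integral. [folklore] -/
theorem ae_eq_const_of_setLIntegral_preimage_eq {Ω S : Type*} [MeasurableSpace Ω] [MeasurableSpace S]
    {P : Measure Ω} [IsFiniteMeasure P] {Γ : Ω → S} (hΓ : AEMeasurable Γ P) {E : Set Ω}
    (hE : MeasurableSet E) {X : Ω → ℝ≥0∞} (hX : ∀ ω, X ω ≤ 1) {G : S → ℝ≥0∞} (hG : Measurable G)
    (hfac : ∀ᵐ ω ∂P, X ω = G (Γ ω)) {p k : ℝ≥0∞} (hp : p ≠ ∞) (hk : k ≠ ∞)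
    (hid : ∀ T : Set S, MeasurableSet T →
      (∫⁻ ω in E ∩ Γ ⁻¹' T, X ω ∂P) * p = k * P (E ∩ Γ ⁻¹' T)) :
    ∀ᵐ ω ∂P, ω ∈ E → X ω * p = k := by
  -- pass to a measurable modification of `Γ`
  set Γ' := hΓ.mk Γ with hΓ'
  have hΓ'm : Measurable Γ' := hΓ.measurable_mk
  have hΓΓ' : Γ =ᵐ[P] Γ' := hΓ.ae_eq_mk
  have hfac' : ∀ᵐ ω ∂P, X ω = G (Γ' ω) := by
    filter_upwards [hfac, hΓΓ'] with ω h1 h2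
    rw [h1, h2]
  have hset : ∀ T : Set S, (E ∩ Γ ⁻¹' T : Set Ω) =ᵐ[P] (E ∩ Γ' ⁻¹' T : Set Ω) := by
    intro T
    refine (ae_eq_refl E).inter ?_
    filter_upwards [hΓΓ'] with ω hω
    simp only [eq_iff_iff]
    change (ω ∈ Γ ⁻¹' T) ↔ (ω ∈ Γ' ⁻¹' T)
    rw [mem_preimage, mem_preimage, hω]
  have hid' : ∀ T : Set S, MeasurableSet T →
      (∫⁻ ω in E ∩ Γ' ⁻¹' T, X ω ∂P) * p = k * P (E ∩ Γ' ⁻¹' T) := by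
    intro T hT
    rw [← measure_congr (hset T), ← setLIntegral_congr (hset T)]
    exact hid T hT
  -- the two test sets
  have hXp_fin : ∀ {U : Set Ω}, (∫⁻ ω in U, X ω * p ∂P) ≠ ∞ := by
    intro U
    refine ne_of_lt ?_
    calc ∫⁻ ω in U, X ω * p ∂P ≤ ∫⁻ _ in U, 1 * p ∂P := lintegral_mono fun ω ↦ by gcongr; exact hX ω
      _ = p * P.restrict U univ := by rw [one_mul, lintegral_const]
      _ < ∞ := ENNReal.mul_lt_top hp.lt_top (measure_lt_top _ _)
  have hzero : ∀ {T : Set S}, MeasurableSet T →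
      (∀ s ∈ T, G s * p < k) ∨ (∀ s ∈ T, k < G s * p) → P (E ∩ Γ' ⁻¹' T) = 0 := by
    intro T hT hcase
    by_contra hne
    have hmeas : MeasurableSet (E ∩ Γ' ⁻¹' T) := hE.inter (hΓ'm hT)
    have hμne : P.restrict (E ∩ Γ' ⁻¹' T) ≠ 0 := by
      intro h0
      exact hne (Measure.restrict_eq_zero.1 h0)
    have hfacU : ∀ᵐ ω ∂P.restrict (E ∩ Γ' ⁻¹' T), X ω = G (Γ' ω) ∧ Γ' ω ∈ T := by
      filter_upwards [ae_restrict_of_ae hfac', ae_restrict_mem hmeas] with ω h1 h2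
      exact ⟨h1, h2.2⟩
    have heq : (∫⁻ ω in E ∩ Γ' ⁻¹' T, X ω * p ∂P) = k * P (E ∩ Γ' ⁻¹' T) := by
      rw [lintegral_mul_const' _ _ hp, hid' T hT]
    rcases hcase with hlt | hgt
    · -- integrand `< k` on a set of positive measure
      have hstrict : (∫⁻ ω in E ∩ Γ' ⁻¹' T, X ω * p ∂P) < ∫⁻ _ in E ∩ Γ' ⁻¹' T, k ∂P := by
        refine lintegral_strict_mono hμne aemeasurable_const hXp_fin ?_
        filter_upwards [hfacU] with ω ⟨h1, h2⟩
        rw [h1]; exact hlt _ h2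
      rw [heq, lintegral_const, Measure.restrict_apply_univ] at hstrict
      exact lt_irrefl _ hstrict
    · have hkfin : (∫⁻ _ in E ∩ Γ' ⁻¹' T, k ∂P) ≠ ∞ := by
        rw [lintegral_const, Measure.restrict_apply_univ]
        exact ENNReal.mul_ne_top hk (measure_ne_top _ _)
      have hstrict : (∫⁻ _ in E ∩ Γ' ⁻¹' T, k ∂P) < ∫⁻ ω in E ∩ Γ' ⁻¹' T, X ω * p ∂P := by
        refine lintegral_strict_mono hμne ?_ hkfin ?_
        · have hGm : AEMeasurable (fun ω ↦ G (Γ' ω) * p) (P.restrict (E ∩ Γ' ⁻¹' T)) :=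
            ((hG.comp hΓ'm).mul_const p).aemeasurable
          refine hGm.congr ?_
          filter_upwards [hfacU] with ω ⟨h1, _⟩
          rw [h1]
        · filter_upwards [hfacU] with ω ⟨h1, h2⟩
          rw [h1]; exact hgt _ h2
      rw [heq, lintegral_const, Measure.restrict_apply_univ] at hstrict
      exact lt_irrefl _ hstrict
  -- conclude
  have h1 : P (E ∩ Γ' ⁻¹' {s | G s * p < k}) = 0 :=
    hzero (measurableSet_lt (hG.mul_const p) measurable_const) (Or.inl fun s hs ↦ hs)
  have h2 : P (E ∩ Γ' ⁻¹' {s | k < G s * p}) = 0 :=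
    hzero (measurableSet_lt measurable_const (hG.mul_const p)) (Or.inr fun s hs ↦ hs)
  have h1' : ∀ᵐ ω ∂P, ω ∉ E ∩ Γ' ⁻¹' {s | G s * p < k} := measure_eq_zero_iff_ae_notMem.1 h1
  have h2' : ∀ᵐ ω ∂P, ω ∉ E ∩ Γ' ⁻¹' {s | k < G s * p} := measure_eq_zero_iff_ae_notMem.1 h2
  filter_upwards [h1', h2', hfac'] with ω hn1 hn2 hf hωE
  rw [hf]
  have a1 : ¬ G (Γ' ω) * p < k := fun h ↦ hn1 ⟨hωE, h⟩
  have a2 : ¬ k < G (Γ' ω) * p := fun h ↦ hn2 ⟨hωE, h⟩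
  exact le_antisymm (not_lt.1 a2) (not_lt.1 a1)

/-! ### The glue: restriction rigidity below 8/3 from the three law-level parts -/

/-- **Restriction rigidity below `8/3` from law-level parts (glue, sorry-free).**
Hypotheses: (L1) the tilted law identity `∫_{E_A ∩ Γ⁻¹T} X_A dP = Φ_A'(0)^α · SLE_κ(D')(T)`; (L2) the
compensator weight `X_A` factors measurably through the SLE curve class `Γ ω`; (L3) `X_A` takes arbitrarily
small values on `E_A` with positive probability. Conclusion: for `0 < κ < 8/3` the restriction identity between
the SLE_κ laws of `D` and of the carved domain at a flat window FAILS. Proof: the identity in canonical form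
(`sleRestriction_canonical_of_identity`) and (L1) give `(∫_{E_A∩Γ⁻¹T} X_A)·P(E_A) = Φ_A'(0)^α·P(E_A∩Γ⁻¹T)` for
all measurable `T`; by (L2) and `ae_eq_const_of_setLIntegral_preimage_eq`, `X_A·P(E_A) = Φ_A'(0)^α` a.e. on
`E_A` (`P(E_A) > 0`, `sleAvoidance_pos`), so `E_A ∩ {X_A < ε}` is null for small `ε`, contradicting (L3).
[cite: LawlerSchrammWerner2003Restriction, Prop. 5.3; Thm. 6.5] [cite: LawlerSchrammWerner2004SAW, §2.1 p. 7] -/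
theorem sleRestrictionRigidityBelow_of_lawParts
    (hL1 : ∀ (κ : ℝ≥0), 0 < κ → κ ≤ 8 / 3 →
      ∀ (D D' : DobrushinDomain) (μ μ' : Measure (CurveClass ℂ)) (x₀ : ℂ) (ρ₀ r : ℝ),
        0 < r → r < ρ₀ →
        D.carrier ∩ Metric.ball x₀ ρ₀ = {z : ℂ | x₀.im < z.im} ∩ Metric.ball x₀ ρ₀ →
        ρ₀ ≤ dist x₀ (D.pt 0) → ρ₀ ≤ dist x₀ (D.pt 1) →
        D'.carrier = D.carrier \ Metric.closedBall x₀ r → D'.pt 0 = D.pt 0 → D'.pt 1 = D.pt 1 →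
        IsSLELaw κ D μ → IsSLELaw κ D' μ' →
        ∀ (Γ : (ℝ≥0 → ℝ) → CurveClass ℂ) (φ : ConformalEquiv upperHalfPlaneSet D.carrier),
          D.IsChordalUniformizing φ → AEMeasurable Γ preWienerMeasure →
          (∀ᵐ ω ∂preWienerMeasure, Loewner.IsGeneratedByCurve (sleDriving κ ω) (sleTrace κ ω) ∧
              ∃ c : Curve ℂ, Γ ω = CurveClass.mk c ∧
                IsCompactifiedImage φ.boundaryExtension (sleTrace κ ω) (D.pt 1) c) →
          μ = preWienerMeasure.map Γ →
          ∀ (Φ : ConformalEquiv (upperHalfPlaneSet \ φ.pullbackHull D') upperHalfPlaneSet),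
            IsRestrictionMap (φ.pullbackHull D') Φ →
            ∀ (d : ℝ), HasRestrictionDeriv (φ.pullbackHull D') Φ d →
            ∀ T : Set (CurveClass ℂ), MeasurableSet T →
              ∫⁻ ω in {ω | Disjoint (range (sleTrace κ ω)) (φ.pullbackHull D')} ∩ Γ ⁻¹' T,
                  poissonAvoidance (sleBubbleIntensity κ *
                    ∫⁻ t, ENNReal.ofReal (starBubbleMass
                      (Loewner.slidHull (sleDriving κ ω) (φ.pullbackHull D') t)) ∂timeMeasure)
                ∂preWienerMeasure =
              ENNReal.ofReal (d ^ sleBubbleExponent κ) * μ' T)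
    (hL2 : ∀ (κ : ℝ≥0), 0 < κ → ∀ (D : DobrushinDomain) (φ : ConformalEquiv upperHalfPlaneSet D.carrier),
      D.IsChordalUniformizing φ → ∀ (A : Set ℂ), IsStarHull A →
        ∃ G : CurveClass ℂ → ℝ≥0∞, Measurable G ∧
          ∀ (Γ : (ℝ≥0 → ℝ) → CurveClass ℂ), ∀ᵐ ω ∂preWienerMeasure,
            (Loewner.IsGeneratedByCurve (sleDriving κ ω) (sleTrace κ ω) ∧
              ∃ c : Curve ℂ, Γ ω = CurveClass.mk c ∧
                IsCompactifiedImage φ.boundaryExtension (sleTrace κ ω) (D.pt 1) c) →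
            poissonAvoidance (sleBubbleIntensity κ *
                ∫⁻ t, ENNReal.ofReal (starBubbleMass (Loewner.slidHull (sleDriving κ ω) A t)) ∂timeMeasure) =
              G (Γ ω))
    (hL3 : ∀ (κ : ℝ≥0), 0 < κ → κ < 8 / 3 → ∀ (A : Set ℂ), IsStarHull A → A.Nonempty →
      ∀ (ε : ℝ), 0 < ε →
        0 < preWienerMeasure {ω | Disjoint (range (sleTrace κ ω)) A ∧
            poissonAvoidance (sleBubbleIntensity κ *
              ∫⁻ t, ENNReal.ofReal (starBubbleMass (Loewner.slidHull (sleDriving κ ω) A t)) ∂timeMeasure) <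
              ENNReal.ofReal ε}) :
    ∀ (κ : ℝ≥0), 0 < κ → κ < 8 / 3 →
      ∀ (D D' : DobrushinDomain) (μ μ' : Measure (CurveClass ℂ)) (x₀ : ℂ) (ρ₀ r : ℝ),
        0 < r → r < ρ₀ →
        D.carrier ∩ Metric.ball x₀ ρ₀ = {z : ℂ | x₀.im < z.im} ∩ Metric.ball x₀ ρ₀ →
        ρ₀ ≤ dist x₀ (D.pt 0) → ρ₀ ≤ dist x₀ (D.pt 1) →
        D'.carrier = D.carrier \ Metric.closedBall x₀ r → D'.pt 0 = D.pt 0 → D'.pt 1 = D.pt 1 →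
        IsSLELaw κ D μ → IsSLELaw κ D' μ' →
        ¬ ∀ T : Set (CurveClass ℂ), MeasurableSet T →
            μ' T * μ {c | r ≤ Metric.infDist x₀ c.range} =
              μ (T ∩ {c | r ≤ Metric.infDist x₀ c.range}) := by
  intro κ hκ hκ83 D D' μ μ' x₀ ρ₀ r hr hrρ hwin ha hb hcar h0 h1 hμ hμ' hid
  haveI := isProbabilityMeasure_preWienerMeasure'
  have h83 : (8 / 3 : ℝ≥0) ≤ 4 := by
    rw [div_le_iff₀ (by norm_num : (0 : ℝ≥0) < 3)]
    norm_num
  have hκ4 : κ ≤ 4 := hκ83.le.trans h83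
  have hsc : ∀ D : JordanDomain, D.isSimplyConnected := JordanDomain.isSimplyConnected_holds
  have hsub : D.IsHullSubdomain D' := isHullSubdomain_of_carved hrρ ha hb hcar h0 h1
  -- canonical form of the identity and positivity of the avoidance event (before destructing `hμ`)
  have hcan := sleRestriction_canonical_of_identity κ hκ hκ4 D D' μ μ' x₀ ρ₀ r hr hrρ hwin ha hb
    hcar h0 h1 hμ hμ' hid
  have hpos := sleAvoidance_pos κ hκ hκ83.le D D' μ x₀ ρ₀ r hrρ ha hb hcar h0 h1 hμ
  have hμcopy := hμ
  -- the SLE curve `Γ` of `D` and its uniformizer `φ`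
  obtain ⟨Γ, hΓ, rfl⟩ := hμ
  obtain ⟨hΓm, φ, hφ, hΓae⟩ := hΓ
  have hdesc : ∀ᵐ ω ∂preWienerMeasure, ∃ c : Curve ℂ, Γ ω = CurveClass.mk c ∧
      IsCompactifiedImage φ.boundaryExtension (sleTrace κ ω) (D.pt 1) c :=
    hΓae.mono fun ω hω ↦ hω.2
  obtain ⟨hPE, hcanT⟩ := hcan Γ φ hφ hΓm hdesc rfl
  -- the pulled-back hull, its restriction map and derivative
  set A : Set ℂ := φ.pullbackHull D' with hAdef
  have hA : IsStarHull A := IsStarHull.pullbackHull hsc hφ hsub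
  have hne : A.Nonempty := pullbackHull_carved_nonempty φ hr hrρ hwin hcar
  obtain ⟨Φ, hΦ, -⟩ := IsStarHull.existsUnique_isRestrictionMap_holds hA
  obtain ⟨d, hd0, -, hd⟩ := IsStarHull.exists_hasRestrictionDeriv_holds hA hΦ
  -- notation
  set E : Set (ℝ≥0 → ℝ) := {ω | Disjoint (range (sleTrace κ ω)) A} with hEdef
  set X : (ℝ≥0 → ℝ) → ℝ≥0∞ := fun ω ↦ poissonAvoidance (sleBubbleIntensity κ *
    ∫⁻ t, ENNReal.ofReal (starBubbleMass (Loewner.slidHull (sleDriving κ ω) A t)) ∂timeMeasure) with hXdef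
  have hPEpos : 0 < preWienerMeasure E := by rw [hEdef, hPE]; exact hpos
  have hPEtop : preWienerMeasure E ≠ ∞ := measure_ne_top _ _
  -- measurability of `E` (a.e. equal to the preimage of a measurable set of curve classes)
  have hκ8 : κ ≠ 8 := by
    intro h8
    have : ((8 : ℝ≥0) : ℝ≥0) ≤ 4 := h8 ▸ hκ4
    norm_num at this
  have hEm : NullMeasurableSet E preWienerMeasure :=
    nullMeasurableSet_setOf_disjoint (κ := κ) hκ8 hA.isBoundedHull.isCompact.isClosed
  obtain ⟨E₀, hE₀sub, hE₀m, hE₀eq⟩ := hEm.exists_measurable_subset_ae_eq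
  -- (L1) + canonical form: the set-integral identities
  have hL1' := hL1 κ hκ hκ83.le D D' (preWienerMeasure.map Γ) μ' x₀ ρ₀ r hr hrρ hwin ha hb hcar h0 h1
    hμcopy hμ' Γ φ hφ hΓm hΓae rfl Φ hΦ d hd
  have hid' : ∀ T : Set (CurveClass ℂ), MeasurableSet T →
      (∫⁻ ω in E₀ ∩ Γ ⁻¹' T, X ω ∂preWienerMeasure) * preWienerMeasure E =
        ENNReal.ofReal (d ^ sleBubbleExponent κ) * preWienerMeasure (E₀ ∩ Γ ⁻¹' T) := by
    intro T hT
    have hsetT : (E₀ ∩ Γ ⁻¹' T : Set (ℝ≥0 → ℝ)) =ᵐ[preWienerMeasure] (E ∩ Γ ⁻¹' T : Set (ℝ≥0 → ℝ)) :=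
      hE₀eq.inter (ae_eq_refl _)
    rw [measure_congr hsetT, setLIntegral_congr hsetT, hL1' T hT, ← hcanT T hT, hEdef, mul_assoc]
  -- (L2): factorisation
  obtain ⟨G, hGm, hfac⟩ := hL2 κ hκ D φ hφ A hA
  have hfacΓ : ∀ᵐ ω ∂preWienerMeasure, X ω = G (Γ ω) := by
    filter_upwards [hfac Γ, hΓae] with ω h1 h2
    exact h1 h2
  -- constancy on `E₀`
  have hconst := ae_eq_const_of_setLIntegral_preimage_eq hΓm hE₀m (fun ω ↦ poissonAvoidance_le_one _)
    hGm hfacΓ hPEtop ENNReal.ofReal_ne_top hid'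
  -- the constant is positive: pick `ε` below it and contradict (L3)
  have hdpos : 0 < d ^ sleBubbleExponent κ := Real.rpow_pos_of_pos hd0 _
  set cst : ℝ≥0∞ := ENNReal.ofReal (d ^ sleBubbleExponent κ) / preWienerMeasure E with hcst
  have hcst_pos : 0 < cst := ENNReal.div_pos (by simpa using hdpos) hPEtop
  have hcst_top : cst ≠ ∞ := ENNReal.div_ne_top ENNReal.ofReal_ne_top hPEpos.ne'
  obtain ⟨ε, hε0, hεlt⟩ : ∃ ε : ℝ, 0 < ε ∧ ENNReal.ofReal ε < cst := by
    have hct : 0 < cst.toReal := ENNReal.toReal_pos hcst_pos.ne' hcst_top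
    refine ⟨cst.toReal / 2, by positivity, ?_⟩
    calc ENNReal.ofReal (cst.toReal / 2) < ENNReal.ofReal cst.toReal :=
          (ENNReal.ofReal_lt_ofReal_iff hct).2 (by linarith)
      _ = cst := ENNReal.ofReal_toReal hcst_top
  have hnull : preWienerMeasure {ω | Disjoint (range (sleTrace κ ω)) A ∧ X ω < ENNReal.ofReal ε} = 0 := by
    rw [measure_eq_zero_iff_ae_notMem]
    have hEE₀ : ∀ᵐ ω ∂preWienerMeasure, ω ∈ E → ω ∈ E₀ := by
      filter_upwards [hE₀eq.mem_iff] with ω hω hωE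
      exact hω.2 hωE
    filter_upwards [hconst, hEE₀] with ω hω hω₀
    rintro ⟨hωE, hlt⟩
    have hXeq : X ω * preWienerMeasure E = ENNReal.ofReal (d ^ sleBubbleExponent κ) := hω (hω₀ hωE)
    have hXcst : X ω = cst := by
      rw [hcst, ENNReal.eq_div_iff hPEpos.ne' hPEtop, mul_comm]
      exact hXeq
    rw [hXcst] at hlt
    exact lt_irrefl _ (hlt.trans hεlt)
  exact (hL3 κ hκ hκ83 A hA hne ε hε0).ne' hnull

/-- **Registered form** (arrow-shaped) of `sleRestrictionRigidityBelow_of_lawParts` (reshape r-c4-7 of the line skeleton: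
`stub_sleRestrictionRigidityBelow := stub_sleRestrictionRigidityBelow_of_lawParts stub_tiltedLawIdentity
stub_compensatorFactorsThroughCurve stub_compensatorEssUnbounded`). [cite: LawlerSchrammWerner2003Restriction, Prop. 5.3; Thm. 6.5] -/
theorem stub_sleRestrictionRigidityBelow_of_lawParts :
    (∀ (κ : ℝ≥0), 0 < κ → κ ≤ 8 / 3 →
      ∀ (D D' : DobrushinDomain) (μ μ' : Measure (CurveClass ℂ)) (x₀ : ℂ) (ρ₀ r : ℝ),
        0 < r → r < ρ₀ →
        D.carrier ∩ Metric.ball x₀ ρ₀ = {z : ℂ | x₀.im < z.im} ∩ Metric.ball x₀ ρ₀ →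
        ρ₀ ≤ dist x₀ (D.pt 0) → ρ₀ ≤ dist x₀ (D.pt 1) →
        D'.carrier = D.carrier \ Metric.closedBall x₀ r → D'.pt 0 = D.pt 0 → D'.pt 1 = D.pt 1 →
        IsSLELaw κ D μ → IsSLELaw κ D' μ' →
        ∀ (Γ : (ℝ≥0 → ℝ) → CurveClass ℂ) (φ : ConformalEquiv upperHalfPlaneSet D.carrier),
          D.IsChordalUniformizing φ → AEMeasurable Γ preWienerMeasure →
          (∀ᵐ ω ∂preWienerMeasure, Loewner.IsGeneratedByCurve (sleDriving κ ω) (sleTrace κ ω) ∧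
              ∃ c : Curve ℂ, Γ ω = CurveClass.mk c ∧
                IsCompactifiedImage φ.boundaryExtension (sleTrace κ ω) (D.pt 1) c) →
          μ = preWienerMeasure.map Γ →
          ∀ (Φ : ConformalEquiv (upperHalfPlaneSet \ φ.pullbackHull D') upperHalfPlaneSet),
            IsRestrictionMap (φ.pullbackHull D') Φ →
            ∀ (d : ℝ), HasRestrictionDeriv (φ.pullbackHull D') Φ d →
            ∀ T : Set (CurveClass ℂ), MeasurableSet T →
              ∫⁻ ω in {ω | Disjoint (range (sleTrace κ ω)) (φ.pullbackHull D')} ∩ Γ ⁻¹' T,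
                  poissonAvoidance (sleBubbleIntensity κ *
                    ∫⁻ t, ENNReal.ofReal (starBubbleMass
                      (Loewner.slidHull (sleDriving κ ω) (φ.pullbackHull D') t)) ∂timeMeasure)
                ∂preWienerMeasure =
              ENNReal.ofReal (d ^ sleBubbleExponent κ) * μ' T) →
    (∀ (κ : ℝ≥0), 0 < κ → ∀ (D : DobrushinDomain) (φ : ConformalEquiv upperHalfPlaneSet D.carrier),
      D.IsChordalUniformizing φ → ∀ (A : Set ℂ), IsStarHull A →
        ∃ G : CurveClass ℂ → ℝ≥0∞, Measurable G ∧
          ∀ (Γ : (ℝ≥0 → ℝ) → CurveClass ℂ), ∀ᵐ ω ∂preWienerMeasure,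
            (Loewner.IsGeneratedByCurve (sleDriving κ ω) (sleTrace κ ω) ∧
              ∃ c : Curve ℂ, Γ ω = CurveClass.mk c ∧
                IsCompactifiedImage φ.boundaryExtension (sleTrace κ ω) (D.pt 1) c) →
            poissonAvoidance (sleBubbleIntensity κ *
                ∫⁻ t, ENNReal.ofReal (starBubbleMass (Loewner.slidHull (sleDriving κ ω) A t)) ∂timeMeasure) =
              G (Γ ω)) →
    (∀ (κ : ℝ≥0), 0 < κ → κ < 8 / 3 → ∀ (A : Set ℂ), IsStarHull A → A.Nonempty →
      ∀ (ε : ℝ), 0 < ε →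
        0 < preWienerMeasure {ω | Disjoint (range (sleTrace κ ω)) A ∧
            poissonAvoidance (sleBubbleIntensity κ *
              ∫⁻ t, ENNReal.ofReal (starBubbleMass (Loewner.slidHull (sleDriving κ ω) A t)) ∂timeMeasure) <
              ENNReal.ofReal ε}) →
    ∀ (κ : ℝ≥0), 0 < κ → κ < 8 / 3 →
      ∀ (D D' : DobrushinDomain) (μ μ' : Measure (CurveClass ℂ)) (x₀ : ℂ) (ρ₀ r : ℝ),
        0 < r → r < ρ₀ →
        D.carrier ∩ Metric.ball x₀ ρ₀ = {z : ℂ | x₀.im < z.im} ∩ Metric.ball x₀ ρ₀ →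
        ρ₀ ≤ dist x₀ (D.pt 0) → ρ₀ ≤ dist x₀ (D.pt 1) →
        D'.carrier = D.carrier \ Metric.closedBall x₀ r → D'.pt 0 = D.pt 0 → D'.pt 1 = D.pt 1 →
        IsSLELaw κ D μ → IsSLELaw κ D' μ' →
        ¬ ∀ T : Set (CurveClass ℂ), MeasurableSet T →
            μ' T * μ {c | r ≤ Metric.infDist x₀ c.range} =
              μ (T ∩ {c | r ≤ Metric.infDist x₀ c.range}) :=
  fun h₁ h₂ h₃ ↦ sleRestrictionRigidityBelow_of_lawParts h₁ h₂ h₃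

end Summit.CriticalPhenomena.SAWScalingLimit.Theorems.SubseqIdentification.BoundaryAreaLaw

end
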